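import Summits.QuantumFields.YangMills.Theorems.BalabanUVNodesN26BetaContMerged
import Literature.Analysis.Calculus.IteratedFDerivParametricIntegral

/-!
# DAG node N26 — B4 «β-continuity», THE FINITE-VOLUME HALF AS A SPEC FOR STAGE 9's β-LAYER TRANSPORT: if the step transport's value is a
# PARAMETRISED FIBRE INTEGRAL `∫_A H(a, (hist, U)) dμ(a)` over a FIXED fibre space (print [I] (2.4): the fluctuation variable `B′`), with an
# integrand smooth in (history, field) for each fibre point, measurable in the fibre point and with dominated derivatives, then the (0.19)-shaped
# term functional `log 𝐍⁻¹(𝐓…)(U) − A_k(…)` is jointly `C²` and the windowed kernels (1.21) are CONTINUOUS IN THE HISTORY at every finite volume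

Cell `pub-ymgap`, YM-PLAN Track A (HUMAN RULING D-0062), seat `pub-ymgap-dag-n26-a` (gen 3; -a = KNIT-BY-NAME); tenth N26 companion — the
constructive counterpart («located WITH repair») of the seat's [LOCATED-B4-VERSION ∕ LOCATED-B4-RSTEP] (pub-ymgap INBOX l.10515; dag-lead TABLE v8
FLAGS; plan g62 rev-1 acceptance test (I3-version), INBOX l.10583).  STATUS OF RECORD: N26 DEPENDENT on (D4), VACATED (closes WITH B3 = N25);
instance 0∕1; nothing here touches the Stage-8 objects (whose transport `Node00.TrhoOfRecord` is a Radon–Nikodym VERSION with no such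
representation) — this file states WHAT a Stage-9 β-layer transport must supply for B4's finite-volume half to be a theorem, and proves that it
then IS one, by name over tree theorems:
* `Literature.Analysis.Calculus.contDiff_integral_of_dominated_iteratedFDeriv` (Hörmander Thm 1.1.9: `C^∞` under the integral sign for a
  measurable family of smooth maps with dominated derivatives) — §2;
* gen 2's `BalabanUVNodesN26Merged.continuousOn_polWindow_of_contDiffAt_config` (joint `C²` of `(x, U) ↦ 𝐄_x(U)` at `(x, 1)` ⇒ the windowed
  kernel `x ↦ polWindow F K j (ℰ x) ρ bV μ ν z` is continuous) — §3.
The `K → ∞` half of (C-pt) (uniform convergence of the windowed kernels on the box: gen 2's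
`BalabanUVNodesN26Record.continuousOn_polLimit_of_tendstoUniformlyOn`) and the per-scale (5.10) decay remain NODE O's estimates; this file does
not touch them.

CONTENTS.
* §1 `contDiffAt_logRatio` — `q ↦ log((𝓣(q.1, u₁))⁻¹ · 𝓣 q)` (the body of (0.19): `A_{k+1}(U) = log 𝐍_k⁻¹ (𝐓_k …)(U)`, `𝐍_k` = the value at the
  reference field `u₁ = 1` AT THE SAME HISTORY) is `Cⁿ` at `(x, u₁)` when `𝓣` is and `𝓣(x, u₁) ≠ 0`.
* §2 `contDiffAt_integral_of_dominated` — the parametrised-fibre-integral sufficient condition for `𝓣` (tree theorem, restated at a point and order).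
* §3 `continuousOn_polWindow_of_logRatioShape` (abstract: `𝓣`, `𝓐` jointly `C²` at `(x, 1)`), **`continuousOn_polWindow_of_fibreIntegral`** (THE SPEC:
  `𝓣 = ∫ H a · dμ` with `H` as above), `continuousOn_polWindow_of_localFibreIntegral` (its LOCAL form — the meetable one: agreement with such an
  integral only NEAR each `(x, 1)`), `finiteVolumeClause_of_fibreIntegral` (the history-box currency of the companions' finite-volume clause `hK`:
  `∀ᶠ K, ContinuousOn (p ↦ polWindow F K (k+1) (ℰ k p K) ρ bV 0 1 z) (Box γc k)`).
* §4 `betaContH_betaOfMerged_of_fibreIntegral` ∕ `n26lit_betaOfMerged_of_fibreIntegral` — the END-TO-END M-test road for the record's design (β):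
  SPEC at every `(k, K)` + NODE O's uniform convergence (hU) and per-scale (5.10) decay (hdec) ⇒ `BetaContH γc (betaOfMerged (betaMerged F ℰ ρ bV) β⁰ γ)`.
HONEST FRAMING: [folklore] calculus glue BY NAME; no definition, no estimate, nothing of Bałaban's asserted; N26 NOT discharged; the hypotheses are a
SPEC for a Stage-9 object that does not exist yet (the Stage-8 β-layer cannot meet them).  One finite four-torus family at fixed ε per run — NOT the
continuum limit, NOT ℝ⁴, NOT OS, NOT a mass gap, NOT Clay.
[Balaban1987RG1] = Commun. Math. Phys. **109** (1987) 249–301: (0.19) p.255, (2.1)–(2.9) pp.265–266 (the fluctuation-variable parametrisation and the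
`B′`-cutoff), (1.20)–(1.22) p.264 («It is a smooth function defined on the interval [0, γ], (or analytic)»).
-/

noncomputable section

open MeasureTheory Filter Topology
open scoped ContDiff Matrix.Norms.L2Operator

namespace Summit.QuantumFields.YangMills.Theorems.BalabanUVNodesN26FiniteVolumeCPt

open Literature.MathematicalPhysics.QuantumFieldTheory.Balaban1983to89
open Literature.MathematicalPhysics.QuantumFieldTheory.Balaban1983to89.FlowStep
open Literature.MathematicalPhysics.QuantumFieldTheory.Balaban1983to89.T4Continuum (T4Family)
open Literature.MathematicalPhysics.QuantumFieldTheory.Balaban1983to89.Node00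

/-! ## §1 The (0.19) body `log 𝐍⁻¹·𝓣` is as smooth as `𝓣`, jointly in (history, field) -/

section LogRatio

variable {X : Type*} [NormedAddCommGroup X] [NormedSpace ℝ X] {U : Type*} [NormedAddCommGroup U] [NormedSpace ℝ U]

/-- **Joint smoothness of the (0.19) body**: if `𝓣 : X × U → ℝ` is `Cⁿ` at `(x, u₁)` and `𝓣(x, u₁) ≠ 0`, then
`q ↦ log((𝓣(q.1, u₁))⁻¹ · 𝓣(q))` — the new action normalised by its value at the reference field `u₁` AT THE SAME parameter `q.1` — is `Cⁿ` at
`(x, u₁)`. [cite: Balaban1987RG1, (0.19) p.255 (folklore calculus on its body)] -/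
theorem contDiffAt_logRatio {n : WithTop ℕ∞} (𝓣 : X × U → ℝ) {x : X} {u₁ : U} (h : ContDiffAt ℝ n 𝓣 (x, u₁)) (h0 : 𝓣 (x, u₁) ≠ 0) :
    ContDiffAt ℝ n (fun q : X × U => Real.log ((𝓣 (q.1, u₁))⁻¹ * 𝓣 q)) (x, u₁) := by
  have hmap : ContDiffAt ℝ n (fun q : X × U => (q.1, u₁)) (x, u₁) := contDiffAt_fst.prodMk contDiffAt_const
  have href : ContDiffAt ℝ n (fun q : X × U => 𝓣 (q.1, u₁)) (x, u₁) := h.comp (x, u₁) hmap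
  refine ((href.inv h0).mul h).log ?_
  show (𝓣 (x, u₁))⁻¹ * 𝓣 (x, u₁) ≠ 0
  rw [inv_mul_cancel₀ h0]
  exact one_ne_zero

/-- The same with a subtracted `Cⁿ` term (the merged term `𝓝_{k+1} = A_{k+1} − A_k(Ū^k(U_k ·))` of [I] (1.6)). [cite: Balaban1987RG1, (1.6) p.261 (folklore calculus)] -/
theorem contDiffAt_logRatio_sub {n : WithTop ℕ∞} (𝓣 𝓐 : X × U → ℝ) {x : X} {u₁ : U} (h : ContDiffAt ℝ n 𝓣 (x, u₁))
    (h0 : 𝓣 (x, u₁) ≠ 0) (h𝓐 : ContDiffAt ℝ n 𝓐 (x, u₁)) :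
    ContDiffAt ℝ n (fun q : X × U => Real.log ((𝓣 (q.1, u₁))⁻¹ * 𝓣 q) - 𝓐 q) (x, u₁) :=
  (contDiffAt_logRatio 𝓣 h h0).sub h𝓐

end LogRatio

/-! ## §2 The parametrised-fibre-integral sufficient condition (tree theorem `contDiff_integral_of_dominated_iteratedFDeriv`, pointed) -/

section FibreIntegral

variable {A : Type*} [MeasurableSpace A] {μA : Measure A} {P : Type*} [NormedAddCommGroup P] [NormedSpace ℝ P]

/-- **Smooth dependence of a parametrised fibre integral on its parameters** (Hörmander Thm 1.1.9 as typed in the tree, pointed form): for a family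
`H a : P → ℝ` of smooth maps, measurable in the fibre point `a` together with all parameter-derivatives, with every derivative order dominated by an
integrable function of `a`, the integral `p ↦ ∫ H a p dμ(a)` is `Cⁿ` at every point, every `n`. [folklore] -/
theorem contDiffAt_integral_of_dominated {H : A → P → ℝ} (h1 : ∀ a, ContDiff ℝ ∞ (H a))
    (h2 : ∀ (n : ℕ) (p : P), AEStronglyMeasurable (fun a => iteratedFDeriv ℝ n (H a) p) μA)
    (h3 : ∀ n : ℕ, ∃ g : A → ℝ, Integrable g μA ∧ ∀ a p, ‖iteratedFDeriv ℝ n (H a) p‖ ≤ g a)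
    {n : WithTop ℕ∞} (hn : n ≤ ∞) (p : P) :
    ContDiffAt ℝ n (fun p => ∫ a, H a p ∂μA) p :=
  ((Literature.Analysis.Calculus.contDiff_integral_of_dominated_iteratedFDeriv h1 h2 h3).of_le hn).contDiffAt

end FibreIntegral

/-! ## §3 THE SPEC: a fibre-integral transport makes the windowed kernels (1.21) continuous in the history at every finite volume -/

section Spec

variable {𝔄 : Type*} [NormedRing 𝔄] [NormedAlgebra ℝ 𝔄] [CompleteSpace 𝔄]
variable {V : Type*} [NormedAddCommGroup V] [NormedSpace ℝ V] {ι : Type*} [Fintype ι]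
variable {X : Type*} [NormedAddCommGroup X] [NormedSpace ℝ X]
variable (F : T4Family) (ρ : V →L[ℝ] 𝔄) (bV : Module.Basis ι ℝ V)

/-- **(C-pt) at finite volume from the (0.19)∕(1.6) SHAPE with jointly `C²` ingredients**: if the term functional on the `K`-th torus is, for every
parameter `x` and field `U`, `ℰ_x(U) = log((𝓣(x, 1))⁻¹ · 𝓣(x, U)) − 𝓐(x, U)` with `𝓣` (the step transport's value) and `𝓐` (the old action along the
background) jointly `C²` at `(x, 1)` and `𝓣(x, 1) ≠ 0` for `x ∈ s`, then every windowed polarisation kernel `x ↦ polWindow F K j (ℰ x) ρ bV μ ν z` is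
continuous on `s` (gen 2's `continuousOn_polWindow_of_contDiffAt_config`). [cite: Balaban1987RG1, (0.19) p.255 and (1.20)-(1.21) p.264 (folklore calculus)] -/
theorem continuousOn_polWindow_of_logRatioShape {s : Set X} (K j : ℕ)
    (ℰ : X → (Fin (F.P K).d → Site (F.P K) j → 𝔄) → ℝ) (𝓣 𝓐 : X × (Fin (F.P K).d → Site (F.P K) j → 𝔄) → ℝ)
    (hrepr : ∀ x W, ℰ x W = Real.log ((𝓣 (x, 1))⁻¹ * 𝓣 (x, W)) - 𝓐 (x, W))
    (h𝓣 : ∀ x ∈ s, ContDiffAt ℝ 2 𝓣 (x, 1)) (h0 : ∀ x ∈ s, 𝓣 (x, 1) ≠ 0) (h𝓐 : ∀ x ∈ s, ContDiffAt ℝ 2 𝓐 (x, 1))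
    (μ ν : Fin 4) (z : Fin 4 → ℤ) : ContinuousOn (fun x => polWindow F K j (ℰ x) ρ bV μ ν z) s := by
  refine BalabanUVNodesN26Merged.continuousOn_polWindow_of_contDiffAt_config F ρ bV K j ℰ (fun x hx => ?_) μ ν z
  have heq : Function.uncurry ℰ =
      fun q : X × (Fin (F.P K).d → Site (F.P K) j → 𝔄) => Real.log ((𝓣 (q.1, 1))⁻¹ * 𝓣 q) - 𝓐 q := by
    funext ⟨x', W⟩
    exact hrepr x' W
  rw [heq]
  exact contDiffAt_logRatio_sub 𝓣 𝓐 (h𝓣 x hx) (h0 x hx) (h𝓐 x hx)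

/-- **THE SPEC — (C-pt) at finite volume from a PARAMETRISED FIBRE-INTEGRAL TRANSPORT**: if the step transport's value at (history, field) is
`𝓣(x, U) = ∫_A H(a, (x, U)) dμ(a)` over a FIXED fibre space `A` (print: the fluctuation variable `B′` of [I] (2.4), cut off by (2.9)'s `χ_k(B′)` — a
factor depending on `a` ONLY), with each `H a` smooth in `(x, U)`, all parameter-derivatives measurable in `a` and dominated by integrable functions of
`a`, if `𝓣(x, 1) ≠ 0` on `s`, and if the subtracted old-action term `𝓐` is jointly `C²` at `(x, 1)`, then the windowed kernels (1.21) of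
`ℰ_x = log((𝓣(x,1))⁻¹ 𝓣(x,·)) − 𝓐(x,·)` are continuous in `x` on `s` at this volume.  What Stage 9's β-layer transport must supply for B4's
finite-volume half; the Stage-8 `TrhoOfRecord` (a Radon–Nikodym version) has no such representation.
[cite: Balaban1987RG1, (2.1)-(2.9) pp.265-266 and (1.20)-(1.22) p.264] -/
theorem continuousOn_polWindow_of_fibreIntegral {A : Type*} [MeasurableSpace A] (μA : Measure A) {s : Set X} (K j : ℕ)
    (ℰ : X → (Fin (F.P K).d → Site (F.P K) j → 𝔄) → ℝ)
    (H : A → X × (Fin (F.P K).d → Site (F.P K) j → 𝔄) → ℝ) (h1 : ∀ a, ContDiff ℝ ∞ (H a))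
    (h2 : ∀ (n : ℕ) (q : X × (Fin (F.P K).d → Site (F.P K) j → 𝔄)), AEStronglyMeasurable (fun a => iteratedFDeriv ℝ n (H a) q) μA)
    (h3 : ∀ n : ℕ, ∃ g : A → ℝ, Integrable g μA ∧ ∀ a q, ‖iteratedFDeriv ℝ n (H a) q‖ ≤ g a)
    (𝓐 : X × (Fin (F.P K).d → Site (F.P K) j → 𝔄) → ℝ)
    (hrepr : ∀ x W, ℰ x W = Real.log ((∫ a, H a (x, 1) ∂μA)⁻¹ * ∫ a, H a (x, W) ∂μA) - 𝓐 (x, W))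
    (h0 : ∀ x ∈ s, (∫ a, H a (x, 1) ∂μA) ≠ 0) (h𝓐 : ∀ x ∈ s, ContDiffAt ℝ 2 𝓐 (x, 1))
    (μ ν : Fin 4) (z : Fin 4 → ℤ) : ContinuousOn (fun x => polWindow F K j (ℰ x) ρ bV μ ν z) s :=
  continuousOn_polWindow_of_logRatioShape F ρ bV K j ℰ (fun q => ∫ a, H a q ∂μA) 𝓐 hrepr
    (fun _ _ => contDiffAt_integral_of_dominated h1 h2 h3 (WithTop.coe_le_coe.mpr le_top) _) h0 h𝓐 μ ν z

/-- **THE SPEC, LOCAL FORM** (the one an instance can meet: print's integrand carries `−1∕g_k²`, so global domination over ALL histories is not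
available — only near each point of the box): it suffices that near each `(x, 1)`, `x ∈ s`, the transport's value AGREES with some parametrised fibre
integral `∫_A H(a, ·) dμ(a)` whose integrand family is smooth with measurable, dominated derivatives (the family may be cut off away from `(x, 1)` at
will). [cite: Balaban1987RG1, (2.1)-(2.9) pp.265-266 and (1.20)-(1.22) p.264] -/
theorem continuousOn_polWindow_of_localFibreIntegral {A : Type*} [MeasurableSpace A] (μA : Measure A) {s : Set X} (K j : ℕ)
    (ℰ : X → (Fin (F.P K).d → Site (F.P K) j → 𝔄) → ℝ) (𝓣 𝓐 : X × (Fin (F.P K).d → Site (F.P K) j → 𝔄) → ℝ)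
    (hrepr : ∀ x W, ℰ x W = Real.log ((𝓣 (x, 1))⁻¹ * 𝓣 (x, W)) - 𝓐 (x, W))
    (hloc : ∀ x ∈ s, ∃ H : A → X × (Fin (F.P K).d → Site (F.P K) j → 𝔄) → ℝ,
      (∀ a, ContDiff ℝ ∞ (H a)) ∧
      (∀ (n : ℕ) (q : X × (Fin (F.P K).d → Site (F.P K) j → 𝔄)), AEStronglyMeasurable (fun a => iteratedFDeriv ℝ n (H a) q) μA) ∧
      (∀ n : ℕ, ∃ g : A → ℝ, Integrable g μA ∧ ∀ a q, ‖iteratedFDeriv ℝ n (H a) q‖ ≤ g a) ∧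
      (fun q => ∫ a, H a q ∂μA) =ᶠ[𝓝 (x, 1)] 𝓣)
    (h0 : ∀ x ∈ s, 𝓣 (x, 1) ≠ 0) (h𝓐 : ∀ x ∈ s, ContDiffAt ℝ 2 𝓐 (x, 1))
    (μ ν : Fin 4) (z : Fin 4 → ℤ) : ContinuousOn (fun x => polWindow F K j (ℰ x) ρ bV μ ν z) s := by
  refine continuousOn_polWindow_of_logRatioShape F ρ bV K j ℰ 𝓣 𝓐 hrepr (fun x hx => ?_) h0 h𝓐 μ ν z
  obtain ⟨H, h1, h2, h3, heq⟩ := hloc x hx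
  exact (contDiffAt_integral_of_dominated h1 h2 h3 (WithTop.coe_le_coe.mpr le_top) _).congr_of_eventuallyEq heq.symm

/-- **The history-box currency** — the companions' finite-volume clause `hK` (`BalabanUVNodesN26Record.n26lit_betaOfTerms_of_finiteVolume`,
`continuousOn_polLimit_of_tendstoUniformlyOn`): for a history-indexed family of term functionals `ℰ k p K` on the tori `T^{(k+1)}_K` given, at EVERY
volume `K`, in the (0.19) shape over a parametrised fibre integral as in `continuousOn_polWindow_of_fibreIntegral` (fibre spaces, measures and
integrands may depend on `k`, `K`), the windowed kernels in channel `(0, 1)` are continuous on the box `]0, γc]^{k+1}` for all `K` — hence eventually.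
(The `K → ∞` uniformity that turns this into (C-pt) for `polLimit` is NODE O's and is NOT claimed.) [cite: Balaban1987RG1, (1.20)-(1.22) p.264] -/
theorem finiteVolumeClause_of_fibreIntegral (γc : ℝ) (ℰ1 : TermFamily1 F 𝔄) (k : ℕ)
    (A : ℕ → Type*) [∀ K, MeasurableSpace (A K)] (μA : (K : ℕ) → Measure (A K))
    (H : (K : ℕ) → A K → (Fin (k + 1) → ℝ) × (Fin (F.P K).d → Site (F.P K) (k + 1) → 𝔄) → ℝ)
    (h1 : ∀ K a, ContDiff ℝ ∞ (H K a))
    (h2 : ∀ K (n : ℕ) q, AEStronglyMeasurable (fun a => iteratedFDeriv ℝ n (H K a) q) (μA K))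
    (h3 : ∀ K (n : ℕ), ∃ g : A K → ℝ, Integrable g (μA K) ∧ ∀ a q, ‖iteratedFDeriv ℝ n (H K a) q‖ ≤ g a)
    (𝓐 : (K : ℕ) → (Fin (k + 1) → ℝ) × (Fin (F.P K).d → Site (F.P K) (k + 1) → 𝔄) → ℝ)
    (hrepr : ∀ K p W, ℰ1 k p K W = Real.log ((∫ a, H K a (p, 1) ∂μA K)⁻¹ * ∫ a, H K a (p, W) ∂μA K) - 𝓐 K (p, W))
    (h0 : ∀ K, ∀ p ∈ Box γc k, (∫ a, H K a (p, 1) ∂μA K) ≠ 0) (h𝓐 : ∀ K, ∀ p ∈ Box γc k, ContDiffAt ℝ 2 (𝓐 K) (p, 1))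
    (z : Fin 4 → ℤ) :
    ∀ᶠ K in atTop, ContinuousOn (fun p : Fin (k + 1) → ℝ => polWindow F K (k + 1) (ℰ1 k p K) ρ bV 0 1 z) (Box γc k) :=
  Eventually.of_forall fun K =>
    continuousOn_polWindow_of_fibreIntegral F ρ bV (μA K) K (k + 1) (fun p => ℰ1 k p K) (H K) (h1 K) (h2 K) (h3 K) (𝓐 K)
      (hrepr K) (h0 K) (h𝓐 K) 0 1 z

/-! ## §4 End-to-end M-test road for the record's design (β): the SPEC at every volume + NODE O's two limit clauses ⇒ B4 -/

/-- **B4 AT THE RECORD's DESIGN (β) — `BetaContH γc (betaOfMerged (betaMerged F ℰ ρ bV) β⁰ γ)` — from the SPEC at every finite volume plus NODE O's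
two limit clauses**: (SPEC) at every step `k` and volume `K` the merged term family `ℰ k · K` has the (0.19)∕(1.6) shape over a parametrised fibre
integral as in `continuousOn_polWindow_of_fibreIntegral` (Stage 9's β-layer transport — NOT available at Stage 8); (hU) the windowed kernels converge
UNIFORMLY on the box as `T^{(k+1)} ↗ ℤ⁴` ([I] p. 264 «This limit exists by the localized representation (1.7)» — NODE O); (hdec) per-scale uniform
(5.10) decay of the limit kernel on the box (NODE O).  Composition BY NAME: `finiteVolumeClause_of_fibreIntegral` ⇒ gen 2's
`BalabanUVNodesN26Record.continuousOn_polLimit_of_tendstoUniformlyOn` ⇒ `….betaContH_betaOfMerged_of_kernel` (M-test, `Beta.BetaContinuity.continuousOn_secondMoment`).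
Declared hypotheses; instance 0∕1; N26 NOT discharged. [cite: Balaban1987RG1, (1.20)-(1.22) p.264 and (5.10) p.293] -/
theorem betaContH_betaOfMerged_of_fibreIntegral (ℰ : TermFamily1 F 𝔄) (β0 : ℕ → ℝ) {γ γc : ℝ} (hle : γc ≤ γ)
    (A : ℕ → ℕ → Type*) [∀ k K, MeasurableSpace (A k K)] (μA : (k K : ℕ) → Measure (A k K))
    (H : (k K : ℕ) → A k K → (Fin (k + 1) → ℝ) × (Fin (F.P K).d → Site (F.P K) (k + 1) → 𝔄) → ℝ)
    (h1 : ∀ k K a, ContDiff ℝ ∞ (H k K a))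
    (h2 : ∀ k K (n : ℕ) q, AEStronglyMeasurable (fun a => iteratedFDeriv ℝ n (H k K a) q) (μA k K))
    (h3 : ∀ k K (n : ℕ), ∃ g : A k K → ℝ, Integrable g (μA k K) ∧ ∀ a q, ‖iteratedFDeriv ℝ n (H k K a) q‖ ≤ g a)
    (𝓐 : (k K : ℕ) → (Fin (k + 1) → ℝ) × (Fin (F.P K).d → Site (F.P K) (k + 1) → 𝔄) → ℝ)
    (hrepr : ∀ k K p W, ℰ k p K W = Real.log ((∫ a, H k K a (p, 1) ∂μA k K)⁻¹ * ∫ a, H k K a (p, W) ∂μA k K) - 𝓐 k K (p, W))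
    (h0 : ∀ k K, ∀ p ∈ Box γc k, (∫ a, H k K a (p, 1) ∂μA k K) ≠ 0)
    (h𝓐 : ∀ k K, ∀ p ∈ Box γc k, ContDiffAt ℝ 2 (𝓐 k K) (p, 1))
    (hU : ∀ k (z : Fin 4 → ℤ), ∃ g : (Fin (k + 1) → ℝ) → ℝ,
      TendstoUniformlyOn (fun K p => polWindow F K (k + 1) (ℰ k p K) ρ bV 0 1 z) g atTop (Box γc k))
    (hdec : ∀ k, ∃ C δ₁ : ℝ, 0 < δ₁ ∧ ∀ p ∈ Box γc k,
      B12Sec2to5.Decay510 (polLimit F (k + 1) (fun K => ℰ k p K) ρ bV 0 1) C δ₁) :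
    BetaContH γc (betaOfMerged (betaMerged F ℰ ρ bV) β0 γ) := by
  refine BalabanUVNodesN26Record.betaContH_betaOfMerged_of_kernel F ρ bV ℰ β0 hle (fun k z => ?_) hdec
  obtain ⟨g, hg⟩ := hU k z
  exact BalabanUVNodesN26Record.continuousOn_polLimit_of_tendstoUniformlyOn F ρ bV (fun (p : Fin (k + 1) → ℝ) K => ℰ k p K) hg
    (finiteVolumeClause_of_fibreIntegral F ρ bV γc ℰ k (A k) (μA k) (H k) (h1 k) (h2 k) (h3 k) (𝓐 k) (hrepr k) (h0 k) (h𝓐 k) z)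

/-- … hence N26's LITERAL for the record's design with `0 < γc ≤ γ`. [cite: Balaban1987RG1, (1.20)-(1.22) p.264 and (5.10) p.293] -/
theorem n26lit_betaOfMerged_of_fibreIntegral (ℰ : TermFamily1 F 𝔄) (β0 : ℕ → ℝ) {γ γc : ℝ} (hγc : 0 < γc) (hle : γc ≤ γ)
    (A : ℕ → ℕ → Type*) [∀ k K, MeasurableSpace (A k K)] (μA : (k K : ℕ) → Measure (A k K))
    (H : (k K : ℕ) → A k K → (Fin (k + 1) → ℝ) × (Fin (F.P K).d → Site (F.P K) (k + 1) → 𝔄) → ℝ)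
    (h1 : ∀ k K a, ContDiff ℝ ∞ (H k K a))
    (h2 : ∀ k K (n : ℕ) q, AEStronglyMeasurable (fun a => iteratedFDeriv ℝ n (H k K a) q) (μA k K))
    (h3 : ∀ k K (n : ℕ), ∃ g : A k K → ℝ, Integrable g (μA k K) ∧ ∀ a q, ‖iteratedFDeriv ℝ n (H k K a) q‖ ≤ g a)
    (𝓐 : (k K : ℕ) → (Fin (k + 1) → ℝ) × (Fin (F.P K).d → Site (F.P K) (k + 1) → 𝔄) → ℝ)
    (hrepr : ∀ k K p W, ℰ k p K W = Real.log ((∫ a, H k K a (p, 1) ∂μA k K)⁻¹ * ∫ a, H k K a (p, W) ∂μA k K) - 𝓐 k K (p, W))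
    (h0 : ∀ k K, ∀ p ∈ Box γc k, (∫ a, H k K a (p, 1) ∂μA k K) ≠ 0)
    (h𝓐 : ∀ k K, ∀ p ∈ Box γc k, ContDiffAt ℝ 2 (𝓐 k K) (p, 1))
    (hU : ∀ k (z : Fin 4 → ℤ), ∃ g : (Fin (k + 1) → ℝ) → ℝ,
      TendstoUniformlyOn (fun K p => polWindow F K (k + 1) (ℰ k p K) ρ bV 0 1 z) g atTop (Box γc k))
    (hdec : ∀ k, ∃ C δ₁ : ℝ, 0 < δ₁ ∧ ∀ p ∈ Box γc k,
      B12Sec2to5.Decay510 (polLimit F (k + 1) (fun K => ℰ k p K) ρ bV 0 1) C δ₁) :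
    ∃ γc : ℝ, 0 < γc ∧ BetaContH γc (betaOfMerged (betaMerged F ℰ ρ bV) β0 γ) :=
  ⟨γc, hγc, betaContH_betaOfMerged_of_fibreIntegral F ρ bV ℰ β0 hle A μA H h1 h2 h3 𝓐 hrepr h0 h𝓐 hU hdec⟩

end Spec

end Summit.QuantumFields.YangMills.Theorems.BalabanUVNodesN26FiniteVolumeCPt

end
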